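import Mathlib
import Summits.NavierStokesRegularity.NavierStokesRegularity.Theorems.SubOnsagerCeilingVirtualFloorWindow4
import HarnessLib

/-!
# Ω-coupled four-shell windows: the unpadded chain interface
(helper file for crux stmt-NavierStokesRegularity-27057 `SubOnsagerCeiling.ForwardTailCeilingKP`, `--supports … --as helper`;
LEAD SOC census v11 §I.5)

`VirtualFloor.window4_le_of_coupledCert` asks for three vanishing bottom shells; the lattice wrapper (like
`chain_shellBarrier_of_game_top`) presents the rescaled chain with ONE vanishing shell `Y 0 = 0` below the datum. This file
pads two further zero shells (rates and dampings continued geometrically downwards) — the same device as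
`gameBarrier_le_one_of_tail_top'`. MODEL lattice; nothing here bears on Navier–Stokes regularity; 27057 stays OPEN.
[cite: BarbatoMorandinRomito2011, §2 Lemma 2.1]
-/

noncomputable section

-- the sub-problem namespace `NavierStokesRegularity.NavierStokesRegularity` is the tree's layout (D-0017)
set_option linter.dupNamespace false

namespace Summit.NavierStokesRegularity.NavierStokesRegularity.Theorems.VirtualFloor

open Set Filter Topology
/-- **Ω-coupled four-shell windows, unpadded interface**: the same conclusion for a chain presented with ONE vanishing
shell below the datum (`Y 0 = 0`, the interface of `chain_shellBarrier_of_game_top`): pad two further zero shells below and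
apply `window4_le_of_coupledCert` (rigid rates and dampings continued geometrically downwards; needs `0 < b2`).
MODEL-lattice ODE lemma. [cite: BarbatoMorandinRomito2011, §2 Lemma 2.1] -/
theorem window4_le_of_coupledCert' {Y : ℕ → ℝ → ℝ} {κ F : ℕ → ℝ} {L p s δ₀ b2 c : ℝ} {K : ℕ}
    {m : ℕ} {a : Fin m → Fin 4 → ℝ} {cf : Fin m → ℝ} {κf εf : Fin 3 → ℝ}
    (hs : 0 < s) (hκ : ∀ n, 0 ≤ κ n) (hκg : ∀ n, κ (n + 1) = b2 * κ n) (hb2 : 0 < b2) (hF : ∀ n, 0 < F n)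
    (hFL : ∀ n, F (n + 1) = L * F n)
    (hInit : ∀ x₀ x₁ x₂ x₃ : ℝ, 0 ≤ x₀ → x₀ ≤ δ₀ → 0 ≤ x₁ → x₁ ≤ δ₀ → 0 ≤ x₂ → x₂ ≤ δ₀ → 0 ≤ x₃ → x₃ ≤ δ₀ →
      (∀ j, a j 0 * x₀ + a j 1 * x₁ + a j 2 * x₂ + a j 3 * x₃ ≤ cf j) ∧
        κf 0 * x₀ ^ 3 - εf 0 ≤ x₁ ∧ κf 1 * x₁ ^ 3 - εf 1 ≤ x₂ ∧ κf 2 * x₂ ^ 3 - εf 2 ≤ x₃)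
    (hSafe : ∀ x₀ x₁ x₂ x₃ : ℝ, 0 ≤ x₀ → 0 ≤ x₁ → 0 ≤ x₂ → 0 ≤ x₃ →
      (∀ j, a j 0 * x₀ + a j 1 * x₁ + a j 2 * x₂ + a j 3 * x₃ ≤ cf j) →
      κf 0 * x₀ ^ 3 - εf 0 ≤ x₁ → κf 1 * x₁ ^ 3 - εf 1 ≤ x₂ → κf 2 * x₂ ^ 3 - εf 2 ≤ x₃ → x₃ ≤ c)
    (hLin : ∀ j, ∀ x₀ x₁ x₂ x₃ v z : ℝ, 0 ≤ x₀ → 0 ≤ x₁ → 0 ≤ x₂ → 0 ≤ x₃ → 0 ≤ v → 0 ≤ z →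
      (∀ j', a j' 0 * x₀ + a j' 1 * x₁ + a j' 2 * x₂ + a j' 3 * x₃ ≤ cf j') →
      κf 0 * x₀ ^ 3 - εf 0 ≤ x₁ → κf 1 * x₁ ^ 3 - εf 1 ≤ x₂ → κf 2 * x₂ ^ 3 - εf 2 ≤ x₃ →
      (∀ j', a j' 0 * v + a j' 1 * x₀ + a j' 2 * x₁ + a j' 3 * x₂ ≤ cf j') →
      κf 0 * v ^ 3 - εf 0 ≤ x₀ → κf 1 * x₀ ^ 3 - εf 1 ≤ x₁ → κf 2 * x₁ ^ 3 - εf 2 ≤ x₂ →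
      (∀ j', a j' 0 * x₁ + a j' 1 * x₂ + a j' 2 * x₃ + a j' 3 * z ≤ cf j') →
      κf 0 * x₁ ^ 3 - εf 0 ≤ x₂ → κf 1 * x₂ ^ 3 - εf 1 ≤ x₃ → κf 2 * x₃ ^ 3 - εf 2 ≤ z →
      a j 0 * x₀ + a j 1 * x₁ + a j 2 * x₂ + a j 3 * x₃ = cf j →
      (a j 0 * (v ^ 2 - p * x₀ * x₁) + a j 1 * (L * (x₀ ^ 2 - p * x₁ * x₂)) +
          a j 2 * (L ^ 2 * (x₁ ^ 2 - p * x₂ * x₃)) + a j 3 * (L ^ 3 * (x₂ ^ 2 - p * x₃ * z)) < 0) ∧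
      0 ≤ a j 0 * x₀ + a j 1 * (b2 * x₁) + a j 2 * (b2 ^ 2 * x₂) + a j 3 * (b2 ^ 3 * x₃))
    (hFlo : ∀ i : Fin 3, ∀ x₀ x₁ x₂ x₃ v z : ℝ, 0 ≤ x₀ → 0 ≤ x₁ → 0 ≤ x₂ → 0 ≤ x₃ → 0 ≤ v → 0 ≤ z →
      (∀ j', a j' 0 * x₀ + a j' 1 * x₁ + a j' 2 * x₂ + a j' 3 * x₃ ≤ cf j') →
      κf 0 * x₀ ^ 3 - εf 0 ≤ x₁ → κf 1 * x₁ ^ 3 - εf 1 ≤ x₂ → κf 2 * x₂ ^ 3 - εf 2 ≤ x₃ →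
      (∀ j', a j' 0 * v + a j' 1 * x₀ + a j' 2 * x₁ + a j' 3 * x₂ ≤ cf j') →
      κf 0 * v ^ 3 - εf 0 ≤ x₀ → κf 1 * x₀ ^ 3 - εf 1 ≤ x₁ → κf 2 * x₁ ^ 3 - εf 2 ≤ x₂ →
      (∀ j', a j' 0 * x₁ + a j' 1 * x₂ + a j' 2 * x₃ + a j' 3 * z ≤ cf j') →
      κf 0 * x₁ ^ 3 - εf 0 ≤ x₂ → κf 1 * x₂ ^ 3 - εf 1 ≤ x₃ → κf 2 * x₃ ^ 3 - εf 2 ≤ z →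
      (if i = 0 then κf 0 * x₀ ^ 3 - εf 0 = x₁ else if i = 1 then κf 1 * x₁ ^ 3 - εf 1 = x₂
        else κf 2 * x₂ ^ 3 - εf 2 = x₃) →
      (if i = 0 then
          3 * κf 0 * x₀ ^ 2 * (v ^ 2 - p * x₀ * x₁) - L * (x₀ ^ 2 - p * x₁ * x₂) < 0 ∧
            0 ≤ 3 * κf 0 * x₀ ^ 2 * x₀ - b2 * x₁
        else if i = 1 then
          3 * κf 1 * x₁ ^ 2 * (L * (x₀ ^ 2 - p * x₁ * x₂)) - L ^ 2 * (x₁ ^ 2 - p * x₂ * x₃) < 0 ∧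
            0 ≤ 3 * κf 1 * x₁ ^ 2 * (b2 * x₁) - b2 ^ 2 * x₂
        else
          3 * κf 2 * x₂ ^ 2 * (L ^ 2 * (x₁ ^ 2 - p * x₂ * x₃)) - L ^ 3 * (x₂ ^ 2 - p * x₃ * z) < 0 ∧
            0 ≤ 3 * κf 2 * x₂ ^ 2 * (b2 ^ 2 * x₂) - b2 ^ 3 * x₃))
    (hY0 : ∀ t, Y 0 t = 0)
    (hcont : ∀ n, ContinuousOn (Y n) (Icc 0 s))
    (hderiv : ∀ n, 1 ≤ n → ∀ t ∈ Ico 0 s, HasDerivWithinAt (Y n)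
      (-κ n * Y n t + F n * (Y (n - 1) t ^ 2 - p * Y n t * Y (n + 1) t)) (Ici t) t)
    (hpos : ∀ n, ∀ t ∈ Icc 0 s, 0 ≤ Y n t)
    (hinit : ∀ n, Y n 0 ≤ δ₀)
    (htail : ∀ n, K ≤ n → ∀ t ∈ Icc 0 s, Y n t ≤ δ₀) :
    ∀ n, ∀ t ∈ Icc 0 s, Y n t ≤ c := by
  have hL : 0 < L := by
    have h1 : 0 < L * F 0 := (hFL 0) ▸ hF 1
    exact pos_of_mul_pos_left h1 (hF 0).le
  have hδ0 : 0 ≤ δ₀ := (hY0 0).symm.le.trans (hinit 0)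
  -- the padded chain (two further zero shells below)
  set Y' : ℕ → ℝ → ℝ := fun n t => if n ≤ 2 then 0 else Y (n - 2) t with hY'
  set κ' : ℕ → ℝ := fun n => κ 0 * b2 ^ n / b2 ^ 2 with hκ'
  set F' : ℕ → ℝ := fun n => F 0 * L ^ n / L ^ 2 with hF'
  have hbk : 0 < b2 ^ 2 := pow_pos hb2 2
  have hLk : 0 < L ^ 2 := pow_pos hL 2
  have hκsh : ∀ j, κ (0 + j) = κ 0 * b2 ^ j := rate_shift hκg 0
  have hFsh : ∀ j, F (0 + j) = F 0 * L ^ j := rate_shift hFL 0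
  have hκ'eq : ∀ j, κ' (2 + j) = κ j := by
    intro j; simp only [hκ']; rw [pow_add, ← zero_add j, hκsh j, zero_add]; field_simp
  have hF'eq : ∀ j, F' (2 + j) = F j := by
    intro j; simp only [hF']; rw [pow_add, ← zero_add j, hFsh j, zero_add]; field_simp
  have hY'lo : ∀ n, n ≤ 2 → ∀ t, Y' n t = 0 := by intro n hn t; simp [hY', hn]
  have hY'hi : ∀ j t, Y' (2 + j) t = Y j t := by
    intro j t; rcases Nat.eq_zero_or_pos j with rfl | hj
    · simp [hY', hY0]
    · simp only [hY']; rw [if_neg (by omega)]; congr 1; omega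
  have hmain := window4_le_of_coupledCert (Y := Y') (κ := κ') (F := F') (K := K + 2) (c := c) hs
    (fun n => by simp only [hκ']; exact div_nonneg (mul_nonneg (hκ 0) (pow_nonneg hb2.le n)) hbk.le)
    (fun n => by simp only [hκ']; rw [pow_succ]; field_simp)
    (fun n => by simp only [hF']; exact div_pos (mul_pos (hF 0) (pow_pos hL n)) hLk)
    (fun n => by simp only [hF']; rw [pow_succ]; field_simp) hInit hSafe hLin hFlo hY'lo ?_ ?_ ?_ ?_ ?_
  · intro n t ht
    have := hmain (2 + n) t ht
    rwa [hY'hi] at this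
  · intro n
    by_cases hn : n ≤ 2
    · have : Y' n = fun _ => 0 := funext (hY'lo n hn)
      rw [this]; exact continuousOn_const
    · obtain ⟨j, rfl⟩ : ∃ j, n = 2 + j := ⟨n - 2, by omega⟩
      have : Y' (2 + j) = Y j := funext (hY'hi j)
      rw [this]; exact hcont j
  · intro n hn t ht
    by_cases hnk : n ≤ 2
    · have h0 : Y' n = fun _ => 0 := funext (hY'lo n hnk)
      have h1 : Y' (n - 1) t = 0 := hY'lo (n - 1) (by omega) t
      rw [h0]
      have : -κ' n * (0 : ℝ) + F' n * (Y' (n - 1) t ^ 2 - p * 0 * Y' (n + 1) t) = 0 := by rw [h1]; ring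
      rw [this]
      exact hasDerivWithinAt_const t (Ici t) 0
    · obtain ⟨j, rfl⟩ : ∃ j, n = 2 + j := ⟨n - 2, by omega⟩
      have hj : 1 ≤ j := by omega
      have h := hderiv j hj t ht
      have e0 : Y' (2 + j) = Y j := funext (hY'hi j)
      have e1 : Y' (2 + j - 1) t = Y (j - 1) t := by
        rw [show 2 + j - 1 = 2 + (j - 1) by omega]; exact hY'hi (j - 1) t
      have e2 : Y' (2 + j + 1) t = Y (j + 1) t := by
        rw [show 2 + j + 1 = 2 + (j + 1) by omega]; exact hY'hi (j + 1) t
      rw [e0, e1, e2, hκ'eq, hF'eq]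
      exact h
  · intro n t ht
    by_cases hn : n ≤ 2
    · rw [hY'lo n hn]
    · obtain ⟨j, rfl⟩ : ∃ j, n = 2 + j := ⟨n - 2, by omega⟩
      rw [hY'hi]; exact hpos j t ht
  · intro n
    by_cases hn : n ≤ 2
    · rw [hY'lo n hn]; exact hδ0
    · obtain ⟨j, rfl⟩ : ∃ j, n = 2 + j := ⟨n - 2, by omega⟩
      rw [hY'hi]; exact hinit j
  · intro n hn t ht
    obtain ⟨j, rfl⟩ : ∃ j, n = 2 + j := ⟨n - 2, by omega⟩
    rw [hY'hi]; exact htail j (by omega) t ht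

end Summit.NavierStokesRegularity.NavierStokesRegularity.Theorems.VirtualFloor

end
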